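import Literature.Analysis.FunctionSpaces.BesselMomentsKernelAnalytic
import Literature.Analysis.FunctionSpaces.BesselMoments
import Mathlib.MeasureTheory.Function.JacobianOneDim
import Mathlib.Analysis.SpecialFunctions.Arcosh
import Mathlib.Analysis.SpecialFunctions.Trigonometric.Inverse
import HarnessLib

/-!
# Boundary values of the rotated Schläfli kernel: `P(x) = eˣK₀(x)`, `P(-r) = e^{-r}(K₀(r) - iπI₀(r))`

Theorem-only sibling of `BesselMomentsKernel.lean` (fourth file towards
`Zhou2017_B3G_sumRule_holds`), connecting `P` with the tree's `besselKReal 0` and `besselI 0`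
of `BesselMoments.lean` (`K₀(x) = ∫₀^∞ e^{-x cosh t} dt`, `I₀(x) = π⁻¹∫₀^π e^{x cos θ} dθ`,
DLMF 10.32.9 / 10.32.1). All substitutions go through Mathlib's one-variable change of variables
`integral_image_eq_integral_abs_deriv_smul`.

* `∫₀^∞ e^{-w} w^{-1/2}(w + 2x)^{-1/2} dw = eˣ K₀(x)` (`x > 0`; `w = x(cosh t - 1)`, whose Jacobian
  `x sinh t` is exactly `(w(w + 2x))^{1/2}`) — DLMF 10.32.8 at `ν = 0`; so `P(x) = eˣK₀(x)`.
* `∫_{2r}^∞ e^{-w} w^{-1/2}(w - 2r)^{-1/2} dw = e^{-r}K₀(r)` (translate) and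
  `∫₀^{2r} e^{-w} w^{-1/2}(2r - w)^{-1/2} dw = e^{-r} π I₀(r)` (`w = r(1 - cos θ)`, Jacobian
  `r sin θ = (w(2r - w))^{1/2}`), so with `(w - 2r)^{-1/2} = -i(2r - w)^{-1/2}` on `w < 2r`
  (principal branch): **`P(-r) = e^{-r}(K₀(r) - iπ I₀(r))`** — the connection formula
  `K₀(re^{iπ}) = K₀(r) - iπ I₀(r)` (DLMF 10.34.2) in this normalisation, proved, not assumed.
* Consequently `F(x) = K₀(x)(K₀(x) + iπI₀(x))` and `F(-x) = K₀(x)(K₀(x) - iπI₀(x))` (`x > 0`):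
  Zhou's `κ(κ + iι sgn)` (Def. 2.1, Lemma 2.2).

## References

* [Zhou2017] Y. Zhou, Hilbert transforms and sum rules of Bessel moments, arXiv:1706.01068,
  Def. 2.1, Lemma 2.2.
* [DLMF] §10.32 (10.32.1, 10.32.8, 10.32.9), §10.34 (10.34.2).
-/

noncomputable section

open MeasureTheory Set Filter
open scoped Topology ComplexConjugate

namespace Literature.Analysis.FunctionSpaces

/-! ### Boundary values of `P` on the real axis -/

/-- `t ↦ x(cosh t - 1)` maps `(0, ∞)` onto `(0, ∞)` (`x > 0`). [folklore] -/
theorem image_mul_cosh_sub_one {x : ℝ} (hx : 0 < x) :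
    (fun t : ℝ => x * (Real.cosh t - 1)) '' Ioi 0 = Ioi 0 := by
  ext w
  constructor
  · rintro ⟨t, ht, rfl⟩
    have : 1 < Real.cosh t := Real.one_lt_cosh.2 (ne_of_gt ht)
    exact mul_pos hx (by linarith)
  · intro hw
    have hw' : 0 < w / x := div_pos hw hx
    refine ⟨Real.arcosh (1 + w / x), Real.arcosh_pos (by linarith), ?_⟩
    show x * (Real.cosh (Real.arcosh (1 + w / x)) - 1) = w
    rw [Real.cosh_arcosh (by linarith)]
    field_simp
    ring

/-- **`P(x) = eˣ K₀(x)` for `x > 0`** (real form): the substitution `w = x(cosh t - 1)` turns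
`∫₀^∞ e^{-w} w^{-1/2} (w + 2x)^{-1/2} dw` into `eˣ ∫₀^∞ e^{-x cosh t} dt` (DLMF 10.32.8 at `ν = 0`).
[folklore] -/
theorem integral_zhouWeight_mul_rpow {x : ℝ} (hx : 0 < x) :
    ∫ w in Ioi (0 : ℝ), zhouWeight w * (w + 2 * x) ^ (-(1 / 2) : ℝ) =
      Real.exp x * besselKReal 0 x := by
  set f : ℝ → ℝ := fun t => x * (Real.cosh t - 1) with hf
  set f' : ℝ → ℝ := fun t => x * Real.sinh t with hf'
  have hderiv : ∀ t ∈ Ioi (0 : ℝ), HasDerivWithinAt f (f' t) (Ioi 0) t := by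
    intro t _
    have : HasDerivAt f (x * Real.sinh t) t := by
      simpa [hf] using ((Real.hasDerivAt_cosh t).sub_const 1).const_mul x
    exact this.hasDerivWithinAt
  have hinj : InjOn f (Ioi 0) := by
    intro a ha b hb hab
    simp only [hf] at hab
    have h1 : Real.cosh a = Real.cosh b := by
      have := mul_left_cancel₀ hx.ne' hab
      linarith
    exact Real.cosh_injOn (Set.mem_Ici.2 (le_of_lt ha)) (Set.mem_Ici.2 (le_of_lt hb)) h1
  have key := integral_image_eq_integral_abs_deriv_smul measurableSet_Ioi hderiv hinj
    (fun w => zhouWeight w * (w + 2 * x) ^ (-(1 / 2) : ℝ))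
  rw [image_mul_cosh_sub_one hx] at key
  rw [key, besselKReal_zero_eq, ← integral_const_mul]
  refine setIntegral_congr_fun measurableSet_Ioi fun t ht => ?_
  have ht' : (0 : ℝ) < t := ht
  have hsinh : 0 < Real.sinh t := Real.sinh_pos_iff.2 ht'
  have hcosh : 1 < Real.cosh t := Real.one_lt_cosh.2 (ne_of_gt ht')
  have hft : 0 < x * (Real.cosh t - 1) := mul_pos hx (by linarith)
  simp only [hf, hf', smul_eq_mul, zhouWeight]
  rw [abs_of_pos (mul_pos hx hsinh)]
  have h1 : (x * (Real.cosh t - 1)) ^ (-(1 / 2) : ℝ) * (x * (Real.cosh t - 1) + 2 * x) ^ (-(1 / 2) : ℝ)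
      = (x * Real.sinh t)⁻¹ := by
    rw [← Real.mul_rpow hft.le (by nlinarith),
      show x * (Real.cosh t - 1) * (x * (Real.cosh t - 1) + 2 * x) = (x * Real.sinh t) ^ 2 by
        linear_combination x ^ 2 * Real.cosh_sq t]
    rw [show ((x * Real.sinh t) ^ 2 : ℝ) = (x * Real.sinh t) ^ (2 : ℝ) by norm_cast,
      ← Real.rpow_mul (mul_pos hx hsinh).le, show (2 : ℝ) * (-(1 / 2)) = -1 by norm_num,
      Real.rpow_neg_one]
  calc x * Real.sinh t * (Real.exp (-(x * (Real.cosh t - 1))) * (x * (Real.cosh t - 1)) ^ (-(1 / 2) : ℝ)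
        * (x * (Real.cosh t - 1) + 2 * x) ^ (-(1 / 2) : ℝ))
      = x * Real.sinh t * (x * Real.sinh t)⁻¹ * Real.exp (-(x * (Real.cosh t - 1))) := by
        rw [mul_assoc (Real.exp _), h1]; ring
    _ = Real.exp (-(x * (Real.cosh t - 1))) := by
        rw [mul_inv_cancel₀ (mul_pos hx hsinh).ne', one_mul]
    _ = Real.exp x * Real.exp (-x * Real.cosh t) := by
        rw [← Real.exp_add]; ring_nf

/-- **`P(x) = eˣ K₀(x)` for `x > 0`.** [folklore] -/
theorem zhouP_ofReal {x : ℝ} (hx : 0 < x) :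
    zhouP x = ((Real.exp x * besselKReal 0 x : ℝ) : ℂ) := by
  rw [← integral_zhouWeight_mul_rpow hx, zhouP, ← integral_complex_ofReal]
  refine setIntegral_congr_fun measurableSet_Ioi fun w hw => ?_
  have hw' : (0 : ℝ) < w := hw
  simp only [zhouIntegrand]
  have : ((w : ℂ) + 2 * (x : ℂ)) = ((w + 2 * x : ℝ) : ℂ) := by push_cast; ring
  rw [this, ← Complex.ofReal_cpow (by linarith : 0 ≤ w + 2 * x)]
  push_cast
  ring

/-- The tail piece of `P(-r)`: `∫_{2r}^∞ k(w)(w - 2r)^{-1/2} dw = e^{-r} K₀(r)` (translate by `2r`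
and use `P(r) = eʳ K₀(r)`). [folklore] -/
theorem integral_Ioi_zhouWeight_mul_rpow_sub {r : ℝ} (hr : 0 < r) :
    ∫ w in Ioi (2 * r), zhouWeight w * (w - 2 * r) ^ (-(1 / 2) : ℝ) =
      Real.exp (-r) * besselKReal 0 r := by
  have hd : ∀ v ∈ Ioi (0 : ℝ), HasDerivWithinAt (fun v : ℝ => v + 2 * r) ((fun _ => (1 : ℝ)) v)
      (Ioi 0) v := fun v _ => ((hasDerivAt_id' v).add_const (2 * r)).hasDerivWithinAt
  have key := integral_image_eq_integral_abs_deriv_smul measurableSet_Ioi hd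
    ((add_left_injective (2 * r)).injOn) (fun w => zhouWeight w * (w - 2 * r) ^ (-(1 / 2) : ℝ))
  rw [image_add_const_Ioi, zero_add] at key
  rw [key]
  simp only [abs_one, one_smul, add_sub_cancel_right]
  have h2 : ∫ v in Ioi (0 : ℝ), zhouWeight (v + 2 * r) * v ^ (-(1 / 2) : ℝ) =
      Real.exp (-(2 * r)) * ∫ v in Ioi (0 : ℝ), zhouWeight v * (v + 2 * r) ^ (-(1 / 2) : ℝ) := by
    rw [← integral_const_mul]
    refine setIntegral_congr_fun measurableSet_Ioi fun v _ => ?_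
    simp only [zhouWeight]
    rw [neg_add, Real.exp_add]
    ring
  rw [h2, integral_zhouWeight_mul_rpow hr, ← mul_assoc, ← Real.exp_add]
  congr 1
  ring_nf

/-- `θ ↦ r(1 - cos θ)` maps `(0, π)` onto `(0, 2r)` (`r > 0`). [folklore] -/
theorem image_mul_one_sub_cos {r : ℝ} (hr : 0 < r) :
    (fun θ : ℝ => r * (1 - Real.cos θ)) '' Ioo 0 Real.pi = Ioo 0 (2 * r) := by
  ext w
  constructor
  · rintro ⟨θ, hθ, rfl⟩
    have h1 : Real.cos θ < 1 := by
      have := Real.cos_lt_cos_of_nonneg_of_le_pi le_rfl hθ.2.le hθ.1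
      rwa [Real.cos_zero] at this
    have h2 : -1 < Real.cos θ := by
      have := Real.cos_lt_cos_of_nonneg_of_le_pi hθ.1.le le_rfl hθ.2
      rwa [Real.cos_pi] at this
    constructor
    · show 0 < r * (1 - Real.cos θ)
      nlinarith
    · show r * (1 - Real.cos θ) < 2 * r
      nlinarith
  · rintro ⟨hw0, hw2⟩
    have h1 : 0 < w / r := div_pos hw0 hr
    have h2 : w / r < 2 := by rw [div_lt_iff₀ hr]; linarith
    refine ⟨Real.arccos (1 - w / r), ⟨Real.arccos_pos.2 (by linarith), Real.arccos_lt_pi.2 (by linarith)⟩,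
      ?_⟩
    show r * (1 - Real.cos (Real.arccos (1 - w / r))) = w
    rw [Real.cos_arccos (by linarith) (by linarith)]
    field_simp
    ring

/-- The head piece of `P(-r)`: `∫₀^{2r} k(w)(2r - w)^{-1/2} dw = e^{-r} π I₀(r)` (substitute
`w = r(1 - cos θ)`, whose Jacobian `r sin θ` cancels `(w(2r - w))^{1/2}` exactly). [folklore] -/
theorem integral_Ioo_zhouWeight_mul_rpow_sub {r : ℝ} (hr : 0 < r) :
    ∫ w in Ioo 0 (2 * r), zhouWeight w * (2 * r - w) ^ (-(1 / 2) : ℝ) =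
      Real.exp (-r) * (Real.pi * besselI 0 r) := by
  set f : ℝ → ℝ := fun θ => r * (1 - Real.cos θ) with hf
  set f' : ℝ → ℝ := fun θ => r * Real.sin θ with hf'
  have hderiv : ∀ θ ∈ Ioo 0 Real.pi, HasDerivWithinAt f (f' θ) (Ioo 0 Real.pi) θ := by
    intro θ _
    have : HasDerivAt f (r * Real.sin θ) θ := by
      have h := ((Real.hasDerivAt_cos θ).const_sub 1).const_mul r
      simpa [hf] using h
    exact this.hasDerivWithinAt
  have hinj : InjOn f (Ioo 0 Real.pi) := by
    intro a ha b hb hab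
    simp only [hf] at hab
    have h1 : Real.cos a = Real.cos b := by
      have := mul_left_cancel₀ hr.ne' hab
      linarith
    exact Real.injOn_cos (Ioo_subset_Icc_self ha) (Ioo_subset_Icc_self hb) h1
  have key := integral_image_eq_integral_abs_deriv_smul measurableSet_Ioo hderiv hinj
    (fun w => zhouWeight w * (2 * r - w) ^ (-(1 / 2) : ℝ))
  rw [image_mul_one_sub_cos hr] at key
  rw [key]
  have hI : Real.pi * besselI 0 r = ∫ θ in Ioo 0 Real.pi, Real.exp (r * Real.cos θ) := by
    rw [besselI_zero_eq, ← mul_assoc, mul_inv_cancel₀ Real.pi_ne_zero, one_mul,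
      intervalIntegral.integral_of_le Real.pi_pos.le, integral_Ioc_eq_integral_Ioo]
  rw [hI, ← integral_const_mul]
  refine setIntegral_congr_fun measurableSet_Ioo fun θ hθ => ?_
  have hsin : 0 < Real.sin θ := Real.sin_pos_of_pos_of_lt_pi hθ.1 hθ.2
  have hc1 : Real.cos θ < 1 := by
    have := Real.cos_lt_cos_of_nonneg_of_le_pi le_rfl hθ.2.le hθ.1
    rwa [Real.cos_zero] at this
  have hc2 : -1 < Real.cos θ := by
    have := Real.cos_lt_cos_of_nonneg_of_le_pi hθ.1.le le_rfl hθ.2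
    rwa [Real.cos_pi] at this
  have hft : 0 < r * (1 - Real.cos θ) := by nlinarith
  simp only [hf, hf', smul_eq_mul, zhouWeight]
  rw [abs_of_pos (mul_pos hr hsin)]
  have h1 : (r * (1 - Real.cos θ)) ^ (-(1 / 2) : ℝ) * (2 * r - r * (1 - Real.cos θ)) ^ (-(1 / 2) : ℝ)
      = (r * Real.sin θ)⁻¹ := by
    rw [← Real.mul_rpow hft.le (by nlinarith),
      show r * (1 - Real.cos θ) * (2 * r - r * (1 - Real.cos θ)) = (r * Real.sin θ) ^ 2 by
        linear_combination (-(r ^ 2)) * Real.sin_sq_add_cos_sq θ]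
    rw [show ((r * Real.sin θ) ^ 2 : ℝ) = (r * Real.sin θ) ^ (2 : ℝ) by norm_cast,
      ← Real.rpow_mul (mul_pos hr hsin).le, show (2 : ℝ) * (-(1 / 2)) = -1 by norm_num,
      Real.rpow_neg_one]
  calc r * Real.sin θ * (Real.exp (-(r * (1 - Real.cos θ))) * (r * (1 - Real.cos θ)) ^ (-(1 / 2) : ℝ)
        * (2 * r - r * (1 - Real.cos θ)) ^ (-(1 / 2) : ℝ))
      = r * Real.sin θ * (r * Real.sin θ)⁻¹ * Real.exp (-(r * (1 - Real.cos θ))) := by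
        rw [mul_assoc (Real.exp _), h1]; ring
    _ = Real.exp (-(r * (1 - Real.cos θ))) := by
        rw [mul_inv_cancel₀ (mul_pos hr hsin).ne', one_mul]
    _ = Real.exp (-r) * Real.exp (r * Real.cos θ) := by
        rw [← Real.exp_add]; ring_nf

/-- `e^{-iπ/2} = -i`. [folklore] -/
theorem exp_pi_mul_I_mul_neg_half :
    Complex.exp (Real.pi * Complex.I * (((-(1 / 2) : ℝ)) : ℂ)) = -Complex.I := by
  have : (Real.pi : ℂ) * Complex.I * (((-(1 / 2) : ℝ)) : ℂ) = -((Real.pi : ℂ) / 2) * Complex.I := by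
    push_cast; ring
  rw [this, Complex.exp_mul_I, Complex.cos_neg, Complex.sin_neg, Complex.cos_pi_div_two,
    Complex.sin_pi_div_two]
  ring

/-- **`P(-r) = e^{-r} (K₀(r) - iπ I₀(r))` for `r > 0`** (the upper boundary value of `e^{z}K₀(z)`
on the cut: `(w - 2r)^{-1/2} = -i (2r - w)^{-1/2}` for `w < 2r` in the principal branch).
[folklore] -/
theorem zhouP_neg_ofReal {r : ℝ} (hr : 0 < r) :
    zhouP (-(r : ℂ)) = ((Real.exp (-r) * besselKReal 0 r : ℝ) : ℂ) -
      ((Real.exp (-r) * (Real.pi * besselI 0 r) : ℝ) : ℂ) * Complex.I := by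
  have hz : (-(r : ℂ)) ≠ 0 := by simpa using hr.ne'
  have hint := integrableOn_zhouIntegrand hz
  rw [zhouP, ← Ioc_union_Ioi_eq_Ioi (by positivity : (0 : ℝ) ≤ 2 * r),
    setIntegral_union Ioc_disjoint_Ioi_same measurableSet_Ioi (hint.mono_set Ioc_subset_Ioi_self)
      (hint.mono_set (Ioi_subset_Ioi (by positivity)))]
  -- head piece
  have hA : ∫ w in Ioc 0 (2 * r), zhouIntegrand (-(r : ℂ)) w =
      ((Real.exp (-r) * (Real.pi * besselI 0 r) : ℝ) : ℂ) * (-Complex.I) := by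
    rw [← integral_Ioo_zhouWeight_mul_rpow_sub hr, ← integral_Ioc_eq_integral_Ioo, ← integral_complex_ofReal,
      ← integral_mul_const]
    refine setIntegral_congr_fun measurableSet_Ioc fun w hw => ?_
    simp only [zhouIntegrand]
    have e1 : ((w : ℂ) + 2 * -(r : ℂ)) = ((w - 2 * r : ℝ) : ℂ) := by push_cast; ring
    rw [e1, Complex.ofReal_cpow_of_nonpos (by linarith [hw.2] : w - 2 * r ≤ 0), exp_pi_mul_I_mul_neg_half]
    have e2 : (-((w - 2 * r : ℝ) : ℂ)) = ((2 * r - w : ℝ) : ℂ) := by push_cast; ring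
    rw [e2, ← Complex.ofReal_cpow (by linarith [hw.2] : 0 ≤ 2 * r - w)]
    push_cast
    ring
  -- tail piece
  have hB : ∫ w in Ioi (2 * r), zhouIntegrand (-(r : ℂ)) w =
      ((Real.exp (-r) * besselKReal 0 r : ℝ) : ℂ) := by
    rw [← integral_Ioi_zhouWeight_mul_rpow_sub hr, ← integral_complex_ofReal]
    refine setIntegral_congr_fun measurableSet_Ioi fun w hw => ?_
    have hw' : 2 * r < w := hw
    simp only [zhouIntegrand]
    have e1 : ((w : ℂ) + 2 * -(r : ℂ)) = ((w - 2 * r : ℝ) : ℂ) := by push_cast; ring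
    rw [e1, ← Complex.ofReal_cpow (by linarith : 0 ≤ w - 2 * r)]
    push_cast
    ring
  rw [hA, hB]
  ring

/-- **The boundary value of `F(z) = P(z) conj P(-conj z)` at `x > 0`:**
`F(x) = K₀(x) (K₀(x) + iπ I₀(x))`. [folklore] -/
theorem zhouP_mul_conj_ofReal_pos {x : ℝ} (hx : 0 < x) :
    zhouP x * conj (zhouP (-(x : ℂ))) =
      (besselKReal 0 x : ℂ) * ((besselKReal 0 x : ℂ) + (Real.pi * besselI 0 x : ℝ) * Complex.I) := by
  rw [zhouP_ofReal hx, zhouP_neg_ofReal hx]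
  simp only [map_sub, map_mul, Complex.conj_ofReal, Complex.conj_I]
  have h : Complex.exp (x : ℂ) * Complex.exp (-(x : ℂ)) = 1 := by
    rw [← Complex.exp_add, add_neg_cancel, Complex.exp_zero]
  push_cast
  linear_combination ((besselKReal 0 x : ℂ) * (besselKReal 0 x : ℂ) +
    (besselKReal 0 x : ℂ) * ((Real.pi : ℂ) * (besselI 0 x : ℂ)) * Complex.I) * h

/-- **The boundary value at `-x < 0`** is the conjugate: `F(-x) = K₀(x)(K₀(x) - iπ I₀(x))`.
[folklore] -/
theorem zhouP_mul_conj_ofReal_neg {x : ℝ} (hx : 0 < x) :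
    zhouP (-(x : ℂ)) * conj (zhouP x) =
      (besselKReal 0 x : ℂ) * ((besselKReal 0 x : ℂ) - (Real.pi * besselI 0 x : ℝ) * Complex.I) := by
  rw [zhouP_ofReal hx, zhouP_neg_ofReal hx]
  simp only [Complex.conj_ofReal]
  have h : Complex.exp (x : ℂ) * Complex.exp (-(x : ℂ)) = 1 := by
    rw [← Complex.exp_add, add_neg_cancel, Complex.exp_zero]
  push_cast
  linear_combination ((besselKReal 0 x : ℂ) * (besselKReal 0 x : ℂ) -
    (besselKReal 0 x : ℂ) * ((Real.pi : ℂ) * (besselI 0 x : ℂ)) * Complex.I) * h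


/-- On the positive axis `F(t) = K₀(t)(K₀(t) + iπI₀(t))`. [folklore] -/
theorem zhouF_ofReal_pos {t : ℝ} (ht : 0 < t) :
    zhouF t = (besselKReal 0 t : ℂ) *
      ((besselKReal 0 t : ℂ) + (Real.pi * besselI 0 t : ℝ) * Complex.I) := by
  rw [zhouF, Complex.conj_ofReal]
  exact zhouP_mul_conj_ofReal_pos ht


/-- On the negative axis `F(-t) = K₀(t)(K₀(t) - iπI₀(t))`. [folklore] -/
theorem zhouF_neg_ofReal_pos {t : ℝ} (ht : 0 < t) :
    zhouF (-(t : ℂ)) = (besselKReal 0 t : ℂ) *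
      ((besselKReal 0 t : ℂ) - (Real.pi * besselI 0 t : ℝ) * Complex.I) := by
  rw [zhouF, map_neg, Complex.conj_ofReal, neg_neg]
  exact zhouP_mul_conj_ofReal_neg ht


end Literature.Analysis.FunctionSpaces
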